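import Summits.NavierStokesRegularity.NavierStokesRegularity.Theorems.AdaptedFrequencyAdaptedFrequencyConvergesStubDoeblinTools

/-!
# Crux `AdaptedFrequencyConverges` (stmt-NavierStokesRegularity-10493), line
  `cloud-frame-effective-tsai`: the adjoint equation as a linear class, for STUB `stub_doeblin`

Helper file (theorems only; lands `--supports stmt-NavierStokesRegularity-10493`) for the
registered stub `stub_doeblin`. The Kato `L¹`-monotonicity hypothesis of the stub is stated for
a jointly `C²` solution `W` of the adjoint equation `∂ₜW + b·∇W + νΔW = 0` on a closed block
`[s, s'] × ℝ³` with a Gaussian envelope. The Doeblin step applies it to signed combinations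
`K₁ − K₂ − W_P + W_N` of kernels and block solutions; this file provides the bookkeeping:

* `doeblin_adj_mono` — restriction of (`C²`, equation with `timeDerivWithin I`) to a smaller time
  set `I'` of unique differentiability (e.g. a closed block);
* `doeblin_adj_sub`, `doeblin_adj_add` — linearity of the class on a time set of unique
  differentiability (`derivWithin`, `fderiv`, `Δ` are additive on `C²` functions);
* `doeblin_kato` — the Kato hypothesis applied on a block `[s, s'] ⊆ S ⊆ (−∞, T)` of a Type-I
  drift `‖b‖ ≤ C/√(T−t)` (drift bound `C/√(T−s')` on the block);
* `doeblin_kato_kernelDiff` — in particular `t ↦ ∫ |K₁(t) − K₂(t)|` is non-decreasing along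
  blocks for two Gaussian-bounded adapted kernels.
-/

noncomputable section

namespace Summit.NavierStokesRegularity.NavierStokesRegularity.Theorems.AdaptedFrequencyConverges.CloudFrameEffectiveTsai

open scoped Topology Laplacian
open Literature.Analysis.FluidPDE Set Filter MeasureTheory Function Metric

/-! ### Slices and time lines of a jointly `C²` function -/

/-- The time slices of a jointly `C²` function on `I × ℝ³` are `C²`. -/
theorem doeblin_contDiff_slice {I : Set ℝ} {W : ℝ → EuclideanSpace ℝ (Fin 3) → ℝ}
    (hc : ContDiffOn ℝ 2 (uncurry W) (I ×ˢ univ)) {τ : ℝ} (hτ : τ ∈ I) : ContDiff ℝ 2 (W τ) := by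
  have h1 : ContDiff ℝ 2
      (fun x : EuclideanSpace ℝ (Fin 3) => ((τ, x) : ℝ × EuclideanSpace ℝ (Fin 3))) :=
    contDiff_const.prodMk contDiff_id
  have := hc.comp_contDiff h1 (fun x => mk_mem_prod hτ (mem_univ x))
  simpa [Function.comp_def] using this

/-- The time lines of a jointly `C²` function on `I × ℝ³` are differentiable within `I`. -/
theorem doeblin_differentiableWithinAt_time {I : Set ℝ} {W : ℝ → EuclideanSpace ℝ (Fin 3) → ℝ}
    (hc : ContDiffOn ℝ 2 (uncurry W) (I ×ˢ univ)) {τ : ℝ} (hτ : τ ∈ I)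
    (x : EuclideanSpace ℝ (Fin 3)) : DifferentiableWithinAt ℝ (fun s => W s x) I τ := by
  have h1 : DifferentiableWithinAt ℝ (uncurry W) (I ×ˢ univ) (τ, x) :=
    (hc.differentiableOn (by norm_num)) (τ, x) (mk_mem_prod hτ (mem_univ x))
  have h2 : DifferentiableWithinAt ℝ (fun s : ℝ => ((s, x) : ℝ × (EuclideanSpace ℝ (Fin 3)))) I τ :=
    differentiableWithinAt_id.prodMk (differentiableWithinAt_const _)
  exact h1.comp τ h2 (fun s hs => mk_mem_prod hs (mem_univ x))

/-- Time slices of a jointly `C²` function are continuous, and time lines are continuous within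
the time set. -/
theorem doeblin_continuousWithinAt_time {I : Set ℝ} {W : ℝ → EuclideanSpace ℝ (Fin 3) → ℝ}
    (hc : ContDiffOn ℝ 2 (uncurry W) (I ×ˢ univ)) {τ : ℝ} (hτ : τ ∈ I)
    (x : EuclideanSpace ℝ (Fin 3)) : ContinuousWithinAt (fun s => W s x) I τ :=
  (doeblin_differentiableWithinAt_time hc hτ x).continuousWithinAt

/-! ### Restriction and linearity of the adjoint equation -/

/-- **Restriction.** A jointly `C²` solution of `∂ₜW + b·∇W + νΔW = 0` on `I × ℝ³` (time
derivative within `I`) is one on `I' × ℝ³` for every `I' ⊆ I` of unique differentiability (the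
one-sided derivatives within `I'` and `I` agree on `I'`, Mathlib `derivWithin_subset`). -/
theorem doeblin_adj_mono {ν : ℝ} {b : ℝ → EuclideanSpace ℝ (Fin 3) → EuclideanSpace ℝ (Fin 3)}
    {I I' : Set ℝ} {W : ℝ → EuclideanSpace ℝ (Fin 3) → ℝ} (hI' : I' ⊆ I) (hU : UniqueDiffOn ℝ I')
    (hc : ContDiffOn ℝ 2 (uncurry W) (I ×ˢ univ))
    (he : ∀ τ ∈ I, ∀ x, timeDerivWithin I W τ x + fderiv ℝ (W τ) x (b τ x) +
      ν * (Δ (W τ)) x = 0) :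
    ContDiffOn ℝ 2 (uncurry W) (I' ×ˢ univ) ∧
      ∀ τ ∈ I', ∀ x, timeDerivWithin I' W τ x + fderiv ℝ (W τ) x (b τ x) +
        ν * (Δ (W τ)) x = 0 := by
  refine ⟨hc.mono (prod_mono hI' Subset.rfl), fun τ hτ x => ?_⟩
  rw [timeDerivWithin_apply,
    derivWithin_subset hI' (hU τ hτ) (doeblin_differentiableWithinAt_time hc (hI' hτ) x),
    ← timeDerivWithin_apply]
  exact he τ (hI' hτ) x

/-- **Linearity (difference).** On a time set of unique differentiability, the difference of two
jointly `C²` solutions of the adjoint equation is a jointly `C²` solution. -/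
theorem doeblin_adj_sub {ν : ℝ} {b : ℝ → EuclideanSpace ℝ (Fin 3) → EuclideanSpace ℝ (Fin 3)}
    {I : Set ℝ} {W₁ W₂ : ℝ → EuclideanSpace ℝ (Fin 3) → ℝ} (hU : UniqueDiffOn ℝ I)
    (hc₁ : ContDiffOn ℝ 2 (uncurry W₁) (I ×ˢ univ))
    (he₁ : ∀ τ ∈ I, ∀ x, timeDerivWithin I W₁ τ x + fderiv ℝ (W₁ τ) x (b τ x) +
      ν * (Δ (W₁ τ)) x = 0)
    (hc₂ : ContDiffOn ℝ 2 (uncurry W₂) (I ×ˢ univ))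
    (he₂ : ∀ τ ∈ I, ∀ x, timeDerivWithin I W₂ τ x + fderiv ℝ (W₂ τ) x (b τ x) +
      ν * (Δ (W₂ τ)) x = 0) :
    ContDiffOn ℝ 2 (uncurry fun τ x => W₁ τ x - W₂ τ x) (I ×ˢ univ) ∧
      ∀ τ ∈ I, ∀ x, timeDerivWithin I (fun τ x => W₁ τ x - W₂ τ x) τ x +
        fderiv ℝ (fun x => W₁ τ x - W₂ τ x) x (b τ x) +
        ν * (Δ (fun x => W₁ τ x - W₂ τ x)) x = 0 := by
  refine ⟨hc₁.sub hc₂, fun τ hτ x => ?_⟩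
  have hd₁ := (doeblin_differentiableWithinAt_time hc₁ hτ x).hasDerivWithinAt
  have hd₂ := (doeblin_differentiableWithinAt_time hc₂ hτ x).hasDerivWithinAt
  have hT : timeDerivWithin I (fun τ x => W₁ τ x - W₂ τ x) τ x =
      timeDerivWithin I W₁ τ x - timeDerivWithin I W₂ τ x := by
    simp only [timeDerivWithin_apply]
    exact (hd₁.sub hd₂).derivWithin (hU τ hτ)
  have hs₁ := doeblin_contDiff_slice hc₁ hτ
  have hs₂ := doeblin_contDiff_slice hc₂ hτ
  have hF : fderiv ℝ (fun x => W₁ τ x - W₂ τ x) x = fderiv ℝ (W₁ τ) x - fderiv ℝ (W₂ τ) x :=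
    fderiv_sub ((hs₁.differentiable (by norm_num)) x) ((hs₂.differentiable (by norm_num)) x)
  have hL : (Δ (fun x => W₁ τ x - W₂ τ x)) x = (Δ (W₁ τ)) x - (Δ (W₂ τ)) x :=
    hs₁.contDiffAt.laplacian_sub hs₂.contDiffAt
  rw [hT, hF, hL, _root_.sub_apply]
  have e₁ := he₁ τ hτ x
  have e₂ := he₂ τ hτ x
  linear_combination e₁ - e₂

/-- **Linearity (sum).** On a time set of unique differentiability, the sum of two jointly `C²`
solutions of the adjoint equation is a jointly `C²` solution. -/
theorem doeblin_adj_add {ν : ℝ} {b : ℝ → EuclideanSpace ℝ (Fin 3) → EuclideanSpace ℝ (Fin 3)}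
    {I : Set ℝ} {W₁ W₂ : ℝ → EuclideanSpace ℝ (Fin 3) → ℝ} (hU : UniqueDiffOn ℝ I)
    (hc₁ : ContDiffOn ℝ 2 (uncurry W₁) (I ×ˢ univ))
    (he₁ : ∀ τ ∈ I, ∀ x, timeDerivWithin I W₁ τ x + fderiv ℝ (W₁ τ) x (b τ x) +
      ν * (Δ (W₁ τ)) x = 0)
    (hc₂ : ContDiffOn ℝ 2 (uncurry W₂) (I ×ˢ univ))
    (he₂ : ∀ τ ∈ I, ∀ x, timeDerivWithin I W₂ τ x + fderiv ℝ (W₂ τ) x (b τ x) +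
      ν * (Δ (W₂ τ)) x = 0) :
    ContDiffOn ℝ 2 (uncurry fun τ x => W₁ τ x + W₂ τ x) (I ×ˢ univ) ∧
      ∀ τ ∈ I, ∀ x, timeDerivWithin I (fun τ x => W₁ τ x + W₂ τ x) τ x +
        fderiv ℝ (fun x => W₁ τ x + W₂ τ x) x (b τ x) +
        ν * (Δ (fun x => W₁ τ x + W₂ τ x)) x = 0 := by
  refine ⟨hc₁.add hc₂, fun τ hτ x => ?_⟩
  have hd₁ := (doeblin_differentiableWithinAt_time hc₁ hτ x).hasDerivWithinAt
  have hd₂ := (doeblin_differentiableWithinAt_time hc₂ hτ x).hasDerivWithinAt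
  have hT : timeDerivWithin I (fun τ x => W₁ τ x + W₂ τ x) τ x =
      timeDerivWithin I W₁ τ x + timeDerivWithin I W₂ τ x := by
    simp only [timeDerivWithin_apply]
    exact (hd₁.add hd₂).derivWithin (hU τ hτ)
  have hs₁ := doeblin_contDiff_slice hc₁ hτ
  have hs₂ := doeblin_contDiff_slice hc₂ hτ
  have hF : fderiv ℝ (fun x => W₁ τ x + W₂ τ x) x = fderiv ℝ (W₁ τ) x + fderiv ℝ (W₂ τ) x :=
    fderiv_add ((hs₁.differentiable (by norm_num)) x) ((hs₂.differentiable (by norm_num)) x)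
  have hL : (Δ (fun x => W₁ τ x + W₂ τ x)) x = (Δ (W₁ τ)) x + (Δ (W₂ τ)) x :=
    hs₁.contDiffAt.laplacian_add hs₂.contDiffAt
  rw [hT, hF, hL, _root_.add_apply]
  have e₁ := he₁ τ hτ x
  have e₂ := he₂ τ hτ x
  linear_combination e₁ + e₂

/-! ### Kato's `L¹` monotonicity on a block of a Type-I drift -/

/-- A Type-I bound `‖b(t, x)‖ ≤ C/√(T − t)` at one time `t < T` forces `C ≥ 0`. -/
theorem doeblin_C_nonneg {C T t : ℝ}
    {b : ℝ → EuclideanSpace ℝ (Fin 3) → EuclideanSpace ℝ (Fin 3)} (ht : t < T)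
    (hbd : ∀ x, ‖b t x‖ ≤ C / Real.sqrt (T - t)) : 0 ≤ C := by
  have h := (norm_nonneg _).trans (hbd 0)
  have hs : 0 < Real.sqrt (T - t) := Real.sqrt_pos.2 (sub_pos.2 ht)
  by_contra hC
  have : C / Real.sqrt (T - t) < 0 := div_neg_of_neg_of_pos (not_le.1 hC) hs
  linarith

/-- On a block `[s, s'] ⊆ S ⊆ (−∞, T)` the Type-I drift is bounded by `C/√(T − s')`. -/
theorem doeblin_drift_bound {C T : ℝ} {S : Set ℝ}
    {b : ℝ → EuclideanSpace ℝ (Fin 3) → EuclideanSpace ℝ (Fin 3)} (hST : S ⊆ Iio T)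
    (hbd : ∀ t ∈ S, ∀ x, ‖b t x‖ ≤ C / Real.sqrt (T - t)) {s s' : ℝ} (hI : Icc s s' ⊆ S)
    (hss' : s ≤ s') :
    ∀ τ ∈ Icc s s', ∀ x, ‖b τ x‖ ≤ C / Real.sqrt (T - s') := by
  intro τ hτ x
  have hs'T : s' < T := hST (hI (right_mem_Icc.2 hss'))
  have hC : 0 ≤ C := doeblin_C_nonneg hs'T (hbd s' (hI (right_mem_Icc.2 hss')))
  refine (hbd τ (hI hτ) x).trans ?_
  exact div_le_div_of_nonneg_left hC (Real.sqrt_pos.2 (sub_pos.2 hs'T))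
    (Real.sqrt_le_sqrt (by linarith [hτ.2]))

/-- **Kato on a block of a Type-I drift.** The Kato `L¹`-monotonicity hypothesis of
`stub_doeblin`, applied on a block `[s, s'] ⊆ S ⊆ (−∞, T)` of a smooth divergence-free Type-I
drift `‖b‖ ≤ C/√(T − t)`, to a jointly `C²` solution of the adjoint equation on the block with a
Gaussian envelope: `∫ |W(s)| ≤ ∫ |W(s')|`. -/
theorem doeblin_kato
    (hKato : ∀ (ν B s s' A a : ℝ)
      (b : ℝ → EuclideanSpace ℝ (Fin 3) → EuclideanSpace ℝ (Fin 3))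
      (W : ℝ → EuclideanSpace ℝ (Fin 3) → ℝ), 0 < ν → s < s' → 0 < a →
      IsSmoothSpaceTimeOn (Icc s s') b → (∀ τ ∈ Icc s s', VectorCalculus.IsDivFree (b τ)) →
      (∀ τ ∈ Icc s s', ∀ x, ‖b τ x‖ ≤ B) → ContDiffOn ℝ 2 (uncurry W) (Icc s s' ×ˢ univ) →
      (∀ τ ∈ Icc s s', ∀ x, timeDerivWithin (Icc s s') W τ x + fderiv ℝ (W τ) x (b τ x) +
        ν * Laplacian.laplacian (W τ) x = 0) →
      (∀ τ ∈ Icc s s', ∀ x, |W τ x| ≤ A * Real.exp (-‖x‖ ^ 2 / a)) →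
      ∫ x, |W s x| ≤ ∫ x, |W s' x|)
    {ν C T : ℝ} {S : Set ℝ} {b : ℝ → EuclideanSpace ℝ (Fin 3) → EuclideanSpace ℝ (Fin 3)}
    (hν : 0 < ν) (hST : S ⊆ Iio T) (hb : IsSmoothSpaceTimeOn S b)
    (hdiv : ∀ t ∈ S, VectorCalculus.IsDivFree (b t))
    (hbd : ∀ t ∈ S, ∀ x, ‖b t x‖ ≤ C / Real.sqrt (T - t)) {s s' : ℝ} (hss' : s < s')
    (hI : Icc s s' ⊆ S) {W : ℝ → EuclideanSpace ℝ (Fin 3) → ℝ}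
    (hc : ContDiffOn ℝ 2 (uncurry W) (Icc s s' ×ˢ univ))
    (he : ∀ τ ∈ Icc s s', ∀ x, timeDerivWithin (Icc s s') W τ x + fderiv ℝ (W τ) x (b τ x) +
      ν * (Δ (W τ)) x = 0)
    (henv : ∃ A a : ℝ, 0 < a ∧ ∀ τ ∈ Icc s s', ∀ x, |W τ x| ≤ A * Real.exp (-‖x‖ ^ 2 / a)) :
    ∫ x, |W s x| ≤ ∫ x, |W s' x| := by
  obtain ⟨A, a, ha, henv⟩ := henv
  exact hKato ν (C / Real.sqrt (T - s')) s s' A a b W hν hss' ha (hb.mono hI)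
    (fun τ hτ => hdiv τ (hI hτ)) (doeblin_drift_bound hST hbd hI hss'.le) hc he henv

/-- **`L¹`-monotonicity of the kernel difference.** For two adapted kernels `K₁, K₂` of the same
drift on `S` with Gaussian upper bounds, and a block `[s, s'] ⊆ S`, `s' < T`:
`∫ |K₁(s) − K₂(s)| ≤ ∫ |K₁(s') − K₂(s')|` (Kato applied to the signed solution `K₁ − K₂`). -/
theorem doeblin_kato_kernelDiff
    (hKato : ∀ (ν B s s' A a : ℝ)
      (b : ℝ → EuclideanSpace ℝ (Fin 3) → EuclideanSpace ℝ (Fin 3))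
      (W : ℝ → EuclideanSpace ℝ (Fin 3) → ℝ), 0 < ν → s < s' → 0 < a →
      IsSmoothSpaceTimeOn (Icc s s') b → (∀ τ ∈ Icc s s', VectorCalculus.IsDivFree (b τ)) →
      (∀ τ ∈ Icc s s', ∀ x, ‖b τ x‖ ≤ B) → ContDiffOn ℝ 2 (uncurry W) (Icc s s' ×ˢ univ) →
      (∀ τ ∈ Icc s s', ∀ x, timeDerivWithin (Icc s s') W τ x + fderiv ℝ (W τ) x (b τ x) +
        ν * Laplacian.laplacian (W τ) x = 0) →
      (∀ τ ∈ Icc s s', ∀ x, |W τ x| ≤ A * Real.exp (-‖x‖ ^ 2 / a)) →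
      ∫ x, |W s x| ≤ ∫ x, |W s' x|)
    {ν C T : ℝ} {S : Set ℝ} {b : ℝ → EuclideanSpace ℝ (Fin 3) → EuclideanSpace ℝ (Fin 3)}
    {x₀ : EuclideanSpace ℝ (Fin 3)} {K₁ K₂ : ℝ → EuclideanSpace ℝ (Fin 3) → ℝ} (hν : 0 < ν)
    (hST : S ⊆ Iio T) (hb : IsSmoothSpaceTimeOn S b)
    (hdiv : ∀ t ∈ S, VectorCalculus.IsDivFree (b t))
    (hbd : ∀ t ∈ S, ∀ x, ‖b t x‖ ≤ C / Real.sqrt (T - t))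
    (hK₁ : IsAdaptedBackwardKernel ν b S T x₀ K₁) (hK₂ : IsAdaptedBackwardKernel ν b S T x₀ K₂)
    {C₁ C₂ : ℝ} (hC₁ : 0 ≤ C₁) (hC₂ : 0 < C₂)
    (hup₁ : ∀ t ∈ S, ∀ x,
      K₁ t x ≤ C₁ * (T - t) ^ (-(3:ℝ) / 2) * Real.exp (-(‖x - x₀‖ ^ 2) / (C₂ * (T - t))))
    (hup₂ : ∀ t ∈ S, ∀ x,
      K₂ t x ≤ C₁ * (T - t) ^ (-(3:ℝ) / 2) * Real.exp (-(‖x - x₀‖ ^ 2) / (C₂ * (T - t))))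
    {s s' : ℝ} (hss' : s < s') (hI : Icc s s' ⊆ S) :
    ∫ x, |K₁ s x - K₂ s x| ≤ ∫ x, |K₁ s' x - K₂ s' x| := by
  have hs'T : s' < T := hST (hI (right_mem_Icc.2 hss'.le))
  have hU : UniqueDiffOn ℝ (Icc s s') := uniqueDiffOn_Icc hss'
  have h₁ := doeblin_adj_mono hI hU hK₁.contDiffOn hK₁.adjoint_eq
  have h₂ := doeblin_adj_mono hI hU hK₂.contDiffOn hK₂.adjoint_eq
  have hD := doeblin_adj_sub hU h₁.1 h₁.2 h₂.1 h₂.2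
  have henv₁ := doeblin_kernel_envelope hC₁ hC₂ hss'.le hs'T hI (fun t ht x => (hK₁.pos t ht x).le)
    hup₁
  have henv₂ := doeblin_kernel_envelope hC₁ hC₂ hss'.le hs'T hI (fun t ht x => (hK₂.pos t ht x).le)
    hup₂
  exact doeblin_kato hKato hν hST hb hdiv hbd hss' hI hD.1 hD.2 (doeblin_envelope_sub henv₁ henv₂)


/-! ### Registered sub-goal -/

/-- **Registered sub-goal `stub_doeblin_katoKernelDiff`** (the explicit form of
`doeblin_kato_kernelDiff`): given Kato `L¹` monotonicity, `t ↦ ∫|K₁(t) − K₂(t)|` is non-decreasing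
along blocks `[s, s'] ⊆ S` for two Gaussian-bounded adapted kernels of a Type-I drift. -/
theorem stub_doeblin_katoKernelDiff :
    (∀ (ν B s s' A a : ℝ) (b : ℝ → (EuclideanSpace ℝ (Fin 3)) → (EuclideanSpace ℝ (Fin 3))) (W : ℝ → (EuclideanSpace ℝ (Fin 3)) → ℝ), 0 < ν → s < s' → 0 < a → IsSmoothSpaceTimeOn (Icc s s') b → (∀ τ ∈ Icc s s', VectorCalculus.IsDivFree (b τ)) → (∀ τ ∈ Icc s s', ∀ x, ‖b τ x‖ ≤ B) → ContDiffOn ℝ 2 (uncurry W) (Icc s s' ×ˢ univ) → (∀ τ ∈ Icc s s', ∀ x, timeDerivWithin (Icc s s') W τ x + fderiv ℝ (W τ) x (b τ x) + ν * Laplacian.laplacian (W τ) x = 0) → (∀ τ ∈ Icc s s', ∀ x, |W τ x| ≤ A * Real.exp (-‖x‖ ^ 2 / a)) → ∫ x, |W s x| ≤ ∫ x, |W s' x|) → ∀ (ν C T : ℝ) (S : Set ℝ) (b : ℝ → (EuclideanSpace ℝ (Fin 3)) → (EuclideanSpace ℝ (Fin 3))) (x₀ : (EuclideanSpace ℝ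 (Fin 3))) (K₁ K₂ : ℝ → (EuclideanSpace ℝ (Fin 3)) → ℝ) (C₁ C₂ s s' : ℝ), 0 < ν → S ⊆ Iio T → IsSmoothSpaceTimeOn S b → (∀ t ∈ S, VectorCalculus.IsDivFree (b t)) → (∀ t ∈ S, ∀ x, ‖b t x‖ ≤ C / Real.sqrt (T - t)) → IsAdaptedBackwardKernel ν b S T x₀ K₁ → IsAdaptedBackwardKernel ν b S T x₀ K₂ → 0 ≤ C₁ → 0 < C₂ → (∀ t ∈ S, ∀ x, K₁ t x ≤ C₁ * (T - t) ^ (-(3:ℝ) / 2) * Real.exp (-(‖x - x₀‖ ^ 2) / (C₂ * (T - t)))) → (∀ t ∈ S, ∀ x, K₂ t x ≤ C₁ * (T - t) ^ (-(3:ℝ) / 2) * Real.exp (-(‖x - x₀‖ ^ 2) / (C₂ * (T - t)))) → s < s' → Icc s s' ⊆ S → ∫ x, |K₁ s x - K₂ s x| ≤ ∫ x, |K₁ s' x - K₂ s' x| :=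
  fun hKato _ _ _ _ _ _ _ _ _ _ _ _ hν hST hb hdiv hbd hK₁ hK₂ hC₁ hC₂ hup₁ hup₂ hss' hI =>
    doeblin_kato_kernelDiff hKato hν hST hb hdiv hbd hK₁ hK₂ hC₁ hC₂ hup₁ hup₂ hss' hI

end Summit.NavierStokesRegularity.NavierStokesRegularity.Theorems.AdaptedFrequencyConverges.CloudFrameEffectiveTsai

end
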